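import Literature.NumberTheory.DiophantineGeometry.FibreConductorSummation
import HarnessLib

/-!
# The conductor slope, single-form variant: `κ ≤ ((m(e+3) − (3e+3))/e)·h(x) + O(1)` from ONE fibre form

Companion of `FibreConductorKappa.lean` (abc-iut cell, route item GenEllTwo = ledger `stmt-ABC-19679`,
work package W5, piece W5d; [GenEll] = S. Mochizuki, *Arithmetic elliptic curves in general position*,
Math. J. Okayama Univ. **52** (2010), Thm. 2.1, proof pp. 12–13).  There the fibre of the auxiliary map
over `B` is indexed root by root (`τ_b = t − b`, which needs `B ⊆ L`); here it is cut out by a SINGLE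
element `u ∈ L` — in the application `u = m_B(t(P))` with `m_B ∈ ℚ[X]` the (monic, separable) polynomial
of the fibre values, so that NO root of `m_B` has to lie in the field `L = ℚ(x, r)` of the point: the local
inequality `1 + ord⁺_w N ≤ ord⁺_w u` at the good meeting places is obtained by the W5 (C) lemma in
`L·ℚ(B)` and pushed down along `w′ ∣ w` (`ord_{w′} = e(w′∣w)·ord_w` on `L`).  Inputs:

* good places (`w ∉ Sbad`): `w ∈ W → 1 + ord⁺_w N ≤ ord⁺_w u`, `w ∉ W → ord⁺_w N ≤ ord⁺_w u`;
* bad places: `Σ_{w∈Sbad} ord⁺_w N·log N(w) ≤ n·C₁`, `Σ_{w∈Sbad} log N(w) ≤ n·C₂`;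
* archimedean separation: `log⁺|N⁻¹|_v ≤ C₃` at every infinite place;
* heights: `e·h_L(u) ≤ m(e+3)·h_L(x) + n·C₄` (`h(m_B(t)) ≤ m·h(t) + O(1)` and W4a's `t`-instance) and
  `(3e+3)·h_L(x) ≤ e·h_L(N) + n·C₅` (W4a's `N`-instance).

Output (`inv_finrank_mul_sum_logNorm_le_slope_single`):
`(1/n)·Σ_{w∈W} log N(w) ≤ ((m(e+3) − (3e+3))/e)·(h_L(x)/n) + (C₄ + C₅)/e + C₁ + C₂ + C₃`.
No definitions; classical; nothing here refers to the disputed parts of the abc-iut corpus.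
[cite: MochizukiGenEll2010, Thm 2.1 proof pp.12-13]
-/

noncomputable section

open NumberField IsDedekindDomain Height Real Finset
open Literature.IUT.LogVolume

namespace Literature.NumberTheory.DiophantineGeometry.FibreConductor

variable {L : Type*} [Field L] [NumberField L]

/-- **The conductor slope from a single fibre form (unnormalised).**
[cite: MochizukiGenEll2010, Thm 2.1 proof pp.12-13] -/
theorem sum_logNorm_le_slope_single (k m : ℕ) (x u N : L)
    (W Sbad : Finset (HeightOneSpectrum (𝓞 L))) {C₁ C₂ C₃ C₄ C₅ : ℝ}
    (hmeet : ∀ w ∈ W, w ∉ Sbad → 1 + (ord L w N).toNat ≤ (ord L w u).toNat)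
    (hoff : ∀ w, w ∉ W → w ∉ Sbad → (ord L w N).toNat ≤ (ord L w u).toNat)
    (hbad₁ : ∑ w ∈ Sbad, ((ord L w N).toNat : ℝ) * logNorm L w ≤ Module.finrank ℚ L * C₁)
    (hbad₂ : ∑ w ∈ Sbad, logNorm L w ≤ Module.finrank ℚ L * C₂)
    (harch : ∀ v : InfinitePlace L, log⁺ (v N⁻¹) ≤ C₃)
    (hu : (2 * k + 1 : ℝ) * logHeight₁ u ≤ m * (2 * k + 4 : ℝ) * logHeight₁ x + Module.finrank ℚ L * C₄)
    (hN : (6 * k + 6 : ℝ) * logHeight₁ x ≤ (2 * k + 1 : ℝ) * logHeight₁ N + Module.finrank ℚ L * C₅) :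
    ∑ w ∈ W, logNorm L w ≤
      ((m * (2 * k + 4 : ℝ) - (6 * k + 6)) / (2 * k + 1)) * logHeight₁ x +
        Module.finrank ℚ L * ((C₄ + C₅) / (2 * k + 1) + C₁ + C₂ + C₃) := by
  set n : ℝ := (Module.finrank ℚ L : ℝ) with hn
  have hnpos : 0 < n := by rw [hn]; exact_mod_cast Module.finrank_pos
  have he : (0 : ℝ) < 2 * k + 1 := by positivity
  have hA : ∑ v : InfinitePlace L, (v.mult : ℝ) * log⁺ (v N⁻¹) ≤ n * C₃ := by
    rw [hn]; exact sum_mult_mul_posLog_inv_le_of_forall N harch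
  have key := sum_logNorm_le_of_good_bad (ι := Unit) N (fun _ : Unit => u) W Sbad
    (A := n * C₃) (C := n * C₁)
    (fun w hw hb => by simpa using hmeet w hw hb) (fun w hw hb => by simpa using hoff w hw hb)
    (by rw [hn]; exact hbad₁) hA
  simp only [Finset.univ_unique, Finset.sum_singleton] at key
  have hbad₂' : ∑ w ∈ Sbad, logNorm L w ≤ n * C₂ := by rw [hn]; exact hbad₂
  have hu' : logHeight₁ u ≤ (m * (2 * k + 4 : ℝ) * logHeight₁ x + n * C₄) / (2 * k + 1) := by
    rw [le_div_iff₀ he]; rw [hn]; linarith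
  have hN' : -logHeight₁ N ≤ (-(6 * k + 6 : ℝ) * logHeight₁ x + n * C₅) / (2 * k + 1) := by
    rw [le_div_iff₀ he]; rw [hn]; linarith
  have htotal : ∑ w ∈ W, logNorm L w ≤
      (m * (2 * k + 4 : ℝ) * logHeight₁ x + n * C₄) / (2 * k + 1) +
        (-(6 * k + 6 : ℝ) * logHeight₁ x + n * C₅) / (2 * k + 1) + n * C₃ + (n * C₁ + n * C₂) := by
    linarith
  have halg : (m * (2 * k + 4 : ℝ) * logHeight₁ x + n * C₄) / (2 * k + 1) +
        (-(6 * k + 6 : ℝ) * logHeight₁ x + n * C₅) / (2 * k + 1) + n * C₃ + (n * C₁ + n * C₂) =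
      ((m * (2 * k + 4 : ℝ) - (6 * k + 6)) / (2 * k + 1)) * logHeight₁ x +
        n * ((C₄ + C₅) / (2 * k + 1) + C₁ + C₂ + C₃) := by
    field_simp
    ring
  rw [hn] at halg htotal
  linarith [htotal, halg.le, halg.ge]

/-- **The conductor slope from a single fibre form, normalised (`hκ` shape).**
`(1/n)·Σ_{w∈W} log N(w) ≤ ((m(e+3) − (3e+3))/e)·(h_L(x)/n) + ((C₄ + C₅)/e + C₁ + C₂ + C₃)`.
[cite: MochizukiGenEll2010, Thm 2.1 proof pp.12-13] -/
theorem inv_finrank_mul_sum_logNorm_le_slope_single (k m : ℕ) (x u N : L)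
    (W Sbad : Finset (HeightOneSpectrum (𝓞 L))) {C₁ C₂ C₃ C₄ C₅ : ℝ}
    (hmeet : ∀ w ∈ W, w ∉ Sbad → 1 + (ord L w N).toNat ≤ (ord L w u).toNat)
    (hoff : ∀ w, w ∉ W → w ∉ Sbad → (ord L w N).toNat ≤ (ord L w u).toNat)
    (hbad₁ : ∑ w ∈ Sbad, ((ord L w N).toNat : ℝ) * logNorm L w ≤ Module.finrank ℚ L * C₁)
    (hbad₂ : ∑ w ∈ Sbad, logNorm L w ≤ Module.finrank ℚ L * C₂)
    (harch : ∀ v : InfinitePlace L, log⁺ (v N⁻¹) ≤ C₃)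
    (hu : (2 * k + 1 : ℝ) * logHeight₁ u ≤ m * (2 * k + 4 : ℝ) * logHeight₁ x + Module.finrank ℚ L * C₄)
    (hN : (6 * k + 6 : ℝ) * logHeight₁ x ≤ (2 * k + 1 : ℝ) * logHeight₁ N + Module.finrank ℚ L * C₅) :
    (Module.finrank ℚ L : ℝ)⁻¹ * ∑ w ∈ W, logNorm L w ≤
      ((m * (2 * k + 4 : ℝ) - (6 * k + 6)) / (2 * k + 1)) * ((Module.finrank ℚ L : ℝ)⁻¹ * logHeight₁ x) +
        ((C₄ + C₅) / (2 * k + 1) + C₁ + C₂ + C₃) := by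
  set n : ℝ := (Module.finrank ℚ L : ℝ) with hn
  have hnpos : 0 < n := by rw [hn]; exact_mod_cast Module.finrank_pos
  have h := sum_logNorm_le_slope_single k m x u N W Sbad hmeet hoff hbad₁ hbad₂ harch hu hN
  rw [← hn] at h
  have h' := mul_le_mul_of_nonneg_left h (inv_nonneg.mpr hnpos.le)
  have hc : n⁻¹ * (n * ((C₄ + C₅) / (2 * k + 1) + C₁ + C₂ + C₃)) = (C₄ + C₅) / (2 * k + 1) + C₁ + C₂ + C₃ := by
    rw [← mul_assoc, inv_mul_cancel₀ hnpos.ne', one_mul]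
  have e1 : n⁻¹ * (((m * (2 * k + 4 : ℝ) - (6 * k + 6)) / (2 * k + 1)) * logHeight₁ x) =
      ((m * (2 * k + 4 : ℝ) - (6 * k + 6)) / (2 * k + 1)) * (n⁻¹ * logHeight₁ x) := by ring
  rw [mul_add, hc, e1] at h'
  exact h'

end Literature.NumberTheory.DiophantineGeometry.FibreConductor
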